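import Summits.ABC.ABC.Theorems.PrimePowerRadical.Negative.WieferichSparse

/-!
# `PrimePowerRadical` (stmt-ABC-1648) implies Silverman's conclusion — why the crux resists PROOF

`IsWieferich q p` (`AbcWave0`, abc.S15) is `q^{p−1} ≡ 1 [MOD p²]`; for an odd prime `p ∤ q` this is `W_p(q) ≥ 2`
(`isWieferich_iff_two_le_wieferichLevel`). If all but finitely many primes were Wieferich to base `q`, then
`rad(q^k − 1) ∣ M · E_W(q,k)` for a fixed `M` (`radical_dvd_of_eventually_wieferich`), the upper sandwich would give
`q^k ≤ 2^{W_2+1} M · k · E_W²`, and Wieferich sparsity (= the crux at `q`) would fail. Hence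
`primePowerRadical_imp_infinite_nonWieferich : PrimePowerRadical → ∀ q prime, {p | p.Prime ∧ ¬ IsWieferich q p}.Infinite`
— Silverman's theorem (J. Number Theory 30 (1988) 226–237, Thm 1) with the hypothesis weakened from abc to
abc-on-the-family `(1, q^k − 1, q^k)`; its conclusion is OPEN for every `q`. Also the negation normal form
`not_primePowerRadical_iff` (what any disproof must exhibit) and three kernel-checked Wieferich witnesses.
-/

noncomputable section

namespace Summit.ABC.ABC.Theorems.PrimePowerRadical.Negative

open Literature.NumberTheory.DiophantineGeometry UniqueFactorizationMonoid
open Summit.ABC.ABC.Theses.IneffectiveSubspace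

/-- For an odd prime `p ∤ q`: `W_p(q) = v_p(q^{p−1} − 1)`. [folklore] -/
theorem wieferichLevel_eq {q p : ℕ} (hq : 2 ≤ q) (hp : p.Prime) (hp2 : p ≠ 2) (hpq : ¬ p ∣ q) :
    wieferichLevel q p = padicValNat p (q ^ (p - 1) - 1) := by
  haveI := Fact.mk hp
  have hp1 : Odd p := hp.odd_of_ne_two hp2
  have hp0 : p - 1 ≠ 0 := by have := hp.two_le; omega
  set x := q ^ (p - 1) with hx
  have hx1 : 1 < x := Nat.one_lt_pow hp0 (by omega)
  have hpx : ¬ p ∣ x := fun h => hpq (hp.dvd_of_dvd_pow h)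
  have hpx1 : p ∣ x - 1 := by
    have := Dioph.prime_dvd_pow_sub_pow_fermat hp hpq (fun h => hp.one_lt.ne' (Nat.dvd_one.mp h))
      (by omega : 1 ≤ q)
    simpa using this
  have h := padicValNat.pow_sub_pow hp1 hx1 hpx1 hpx two_ne_zero
  rw [one_pow, padicValNat.eq_zero_of_not_dvd
    (fun h2 => hp2 ((Nat.prime_dvd_prime_iff_eq hp Nat.prime_two).mp h2)), add_zero] at h
  unfold wieferichLevel
  rw [← h, hx, ← pow_mul, mul_comm]

/-- For an odd prime `p ∤ q`: `p` is Wieferich to base `q` iff `W_p(q) ≥ 2`. [folklore] -/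
theorem isWieferich_iff_two_le_wieferichLevel {q p : ℕ} (hq : 2 ≤ q) (hp : p.Prime) (hp2 : p ≠ 2)
    (hpq : ¬ p ∣ q) : IsWieferich q p ↔ 2 ≤ wieferichLevel q p := by
  haveI := Fact.mk hp
  have hp0 : p - 1 ≠ 0 := by have := hp.two_le; omega
  have h1 : 1 ≤ q ^ (p - 1) := Nat.one_le_pow _ _ (by omega)
  have hne : q ^ (p - 1) - 1 ≠ 0 := by
    have := Nat.one_lt_pow hp0 (by omega : 1 < q); omega
  rw [wieferichLevel_eq hq hp hp2 hpq, IsWieferich, ← padicValNat_dvd_iff_le hne]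
  constructor
  · intro h; exact (Nat.modEq_iff_dvd' h1).mp h.symm
  · intro h; exact ((Nat.modEq_iff_dvd' h1).mpr h).symm

/-- If every odd prime `p > P₀` not dividing `q` is Wieferich to base `q`, then `rad(q^k − 1)` divides
`(∏_{p ≤ P₀ prime} p) · 2 · E_W(q,k)`. [folklore] -/
theorem radical_dvd_of_eventually_wieferich {q k : ℕ} (hq : q.Prime) (hk : 1 ≤ k) (P₀ : ℕ)
    (hW : ∀ p : ℕ, p.Prime → p ≠ 2 → P₀ < p → ¬ p ∣ q → 2 ≤ wieferichLevel q p) :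
    radical (q ^ k - 1) ∣
      (∏ p ∈ (Finset.range (P₀ + 1)).filter Nat.Prime, p) * 2 * oddWieferichExcess q k := by
  set P := ∏ p ∈ (Finset.range (P₀ + 1)).filter Nat.Prime, p with hP
  have hP0 : P ≠ 0 := Finset.prod_ne_zero_iff.mpr fun p hp => (Finset.mem_filter.mp hp).2.ne_zero
  have hE0 := (oddWieferichExcess_pos q k).ne'
  have hM0 : P * 2 * oddWieferichExcess q k ≠ 0 := mul_ne_zero (mul_ne_zero hP0 two_ne_zero) hE0
  rw [Nat.radical_dvd_iff hM0]
  intro r hr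
  have hrp : r.Prime := Nat.prime_of_mem_primeFactors hr
  have hrn : r ∣ q ^ k - 1 := Nat.dvd_of_mem_primeFactors hr
  refine Nat.mem_primeFactors.mpr ⟨hrp, ?_, hM0⟩
  by_cases hr2 : r = 2
  · subst hr2; exact dvd_mul_of_dvd_left (dvd_mul_left 2 P) _
  by_cases hrP : r ≤ P₀
  · have : r ∣ P := Finset.dvd_prod_of_mem _
      (Finset.mem_filter.mpr ⟨Finset.mem_range.mpr (by omega), hrp⟩)
    exact dvd_mul_of_dvd_left (dvd_mul_of_dvd_left this 2) _
  · have hrq : ¬ r ∣ q := not_dvd_base_of_dvd hrp hk hq.one_lt.le hrn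
    have h2 := hW r hrp hr2 (by omega) hrq
    have : r ∣ oddWieferichExcess q k := by
      have hmem : r ∈ (q ^ k - 1).primeFactors.erase 2 := Finset.mem_erase.mpr ⟨hr2, hr⟩
      exact dvd_trans (dvd_pow_self r (by omega)) (Finset.dvd_prod_of_mem _ hmem)
    exact dvd_mul_of_dvd_right this _

/-- **Wieferich sparsity at `q` forces infinitely many non-Wieferich primes to base `q`.** [folklore] -/
theorem infinite_nonWieferich_of_wieferichSparse {q : ℕ} (hq : q.Prime) (h : (∀ ε : ℝ, 0 < ε → ∃ C : ℝ, 0 < C ∧ ∀ k : ℕ, 1 ≤ k →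
      (oddWieferichExcess q k : ℝ) < C * (q : ℝ) ^ (ε * k))) :
    {p : ℕ | p.Prime ∧ ¬ IsWieferich q p}.Infinite := by
  intro hfin
  obtain ⟨P₀, hP₀⟩ := hfin.bddAbove
  have hq2 := hq.two_le
  have hW : ∀ p : ℕ, p.Prime → p ≠ 2 → P₀ < p → ¬ p ∣ q → 2 ≤ wieferichLevel q p := by
    intro p hp hp2 hpP hpq
    rw [← isWieferich_iff_two_le_wieferichLevel hq2 hp hp2 hpq]
    by_contra hw
    have : p ≤ P₀ := hP₀ ⟨hp, hw⟩
    omega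
  -- the fixed modulus M and the sparsity constant at ε = 1/6
  set P := ∏ p ∈ (Finset.range (P₀ + 1)).filter Nat.Prime, p with hP
  have hP0 : P ≠ 0 := Finset.prod_ne_zero_iff.mpr fun p hp => (Finset.mem_filter.mp hp).2.ne_zero
  obtain ⟨C, hC, hE⟩ := h (1 / 6) (by norm_num)
  have hq0 : (0 : ℝ) < q := by exact_mod_cast hq.pos
  have hq1 : (1 : ℝ) < q := by exact_mod_cast hq.one_lt
  have hlogq : 0 < Real.log q := Real.log_pos hq1
  set W := wieferichLevel q 2 with hWdef
  -- K := 2^(W+1) * (2P) * C^2 * 6 / log q bounds q^(k/2) for every k ≥ 1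
  set K : ℝ := 2 ^ (W + 1) * (2 * P) * C ^ 2 * (6 / Real.log q) with hK
  have hK0 : 0 < K := by
    have : (0 : ℝ) < P := by exact_mod_cast Nat.pos_of_ne_zero hP0
    positivity
  have hbound : ∀ k : ℕ, 1 ≤ k → (q : ℝ) ^ ((1 / 2 : ℝ) * k) < K := by
    intro k hk
    set E : ℝ := (oddWieferichExcess q k : ℝ) with hEdef
    set R : ℝ := ((radical (q ^ k - 1) : ℕ) : ℝ) with hRdef
    have hE0 : 0 < E := by rw [hEdef]; exact_mod_cast oddWieferichExcess_pos q k
    have h1 : (q : ℝ) ^ k ≤ 2 * k * R * E * 2 ^ W := pow_le_mul_oddWieferichExcess_real hq hk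
    have h2 : R ≤ 2 * P * E := by
      have hd := radical_dvd_of_eventually_wieferich hq hk P₀ hW
      have hM0 : P * 2 * oddWieferichExcess q k ≠ 0 :=
        mul_ne_zero (mul_ne_zero hP0 two_ne_zero) (oddWieferichExcess_pos q k).ne'
      have hle := Nat.le_of_dvd (Nat.pos_of_ne_zero hM0) hd
      have : ((radical (q ^ k - 1) : ℕ) : ℝ) ≤ ((P * 2 * oddWieferichExcess q k : ℕ) : ℝ) := by
        exact_mod_cast hle
      rw [hRdef]; push_cast at this ⊢; linarith
    have h3 : E < C * (q : ℝ) ^ ((1 / 6 : ℝ) * k) := hE k hk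
    have h4 : (k : ℝ) * ((1 / 6 : ℝ) * Real.log q) < (q : ℝ) ^ ((1 / 6 : ℝ) * k) :=
      nat_mul_lt_rpow hq2 (1 / 6) k
    have hQ : (0 : ℝ) < (q : ℝ) ^ ((1 / 6 : ℝ) * k) := Real.rpow_pos_of_pos hq0 _
    have hk0 : (0 : ℝ) < k := by exact_mod_cast (by omega : 0 < k)
    -- q^k ≤ 2^(W+1) (2P) k E^2 < 2^(W+1) (2P) (Q · 6/log q) (C Q)^2 = K Q^3
    have h5 : (q : ℝ) ^ k < K * ((q : ℝ) ^ ((1 / 6 : ℝ) * k)) ^ 3 := by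
      have hk' : (k : ℝ) < (q : ℝ) ^ ((1 / 6 : ℝ) * k) * (6 / Real.log q) := by
        rw [← div_lt_iff₀ (by positivity)]
        calc (k : ℝ) / (6 / Real.log q) = k * ((1 / 6 : ℝ) * Real.log q) := by field_simp
          _ < _ := h4
      have hE2 : E ^ 2 < (C * (q : ℝ) ^ ((1 / 6 : ℝ) * k)) ^ 2 := by
        exact pow_lt_pow_left₀ h3 hE0.le two_ne_zero
      calc (q : ℝ) ^ k ≤ 2 * k * R * E * 2 ^ W := h1
        _ ≤ 2 * k * (2 * P * E) * E * 2 ^ W := by gcongr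
        _ = 2 ^ (W + 1) * (2 * P) * (k * E ^ 2) := by ring
        _ < 2 ^ (W + 1) * (2 * P) *
              (((q : ℝ) ^ ((1 / 6 : ℝ) * k) * (6 / Real.log q)) * (C * (q : ℝ) ^ ((1 / 6 : ℝ) * k)) ^ 2) := by
            have hP' : (0 : ℝ) < 2 ^ (W + 1) * (2 * P) := by
              have : (0 : ℝ) < P := by exact_mod_cast Nat.pos_of_ne_zero hP0
              positivity
            apply mul_lt_mul_of_pos_left _ hP'
            exact mul_lt_mul'' hk' hE2 hk0.le (by positivity)
        _ = K * ((q : ℝ) ^ ((1 / 6 : ℝ) * k)) ^ 3 := by rw [hK]; ring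
    -- ((q^(k/6))^3 = q^(k/2); q^k = q^(k/2) * q^(k/2)
    have h6 : ((q : ℝ) ^ ((1 / 6 : ℝ) * k)) ^ 3 = (q : ℝ) ^ ((1 / 2 : ℝ) * k) := by
      rw [← Real.rpow_natCast, ← Real.rpow_mul hq0.le]; norm_num; ring_nf
    have h7 : (q : ℝ) ^ k = (q : ℝ) ^ ((1 / 2 : ℝ) * k) * (q : ℝ) ^ ((1 / 2 : ℝ) * k) := by
      rw [← Real.rpow_add hq0, ← Real.rpow_natCast]; ring_nf
    rw [h6, h7] at h5
    have hH : (0 : ℝ) < (q : ℝ) ^ ((1 / 2 : ℝ) * k) := Real.rpow_pos_of_pos hq0 _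
    -- Q2 * Q2 < K * Q2 ⟹ Q2 < K
    nlinarith
  -- but q^(k/2) is unbounded: q^(k/2) ≥ 1 + (k/2) log q
  obtain ⟨k, hk⟩ := exists_nat_gt (2 * K / Real.log q)
  have hk1 : 1 ≤ k + 1 := by omega
  have h := hbound (k + 1) hk1
  have hexp : 1 + (1 / 2 : ℝ) * (k + 1 : ℕ) * Real.log q ≤ (q : ℝ) ^ ((1 / 2 : ℝ) * (k + 1 : ℕ)) := by
    rw [Real.rpow_def_of_pos hq0]
    have := Real.add_one_le_exp (Real.log q * ((1 / 2 : ℝ) * (k + 1 : ℕ)))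
    linarith
  rw [div_lt_iff₀ hlogq] at hk
  push_cast at hexp h hk
  nlinarith

/-- **`PrimePowerRadical` ⟹ infinitely many non-Wieferich primes to every prime base** (Silverman,
J. Number Theory 30 (1988), Thm 1, with the hypothesis abc weakened to abc on the family `(1, q^k − 1, q^k)`).
The conclusion is open for every `q`; this is the formal content of "the crux is itself an open problem"
(route why-might-fail). [cite: Silverman1988, Thm 1] -/
theorem primePowerRadical_imp_infinite_nonWieferich (h : PrimePowerRadical) (q : ℕ) (hq : q.Prime) :
    {p : ℕ | p.Prime ∧ ¬ IsWieferich q p}.Infinite :=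
  infinite_nonWieferich_of_wieferichSparse hq ((PPRAt_iff_wieferichSparse hq).mp (h q hq))

/-- **Shape of any disproof.** `PrimePowerRadical` fails iff at some prime base `q` the odd Wieferich
excess is exponentially large infinitely often: `∃ ε > 0, ∀ C > 0, ∃ k ≥ 1, C · q^{εk} ≤ E_W(q,k)`.
Since `E_W(q,k) = ∏_{p odd Wieferich base q, p ∣ q^k−1} p^{W_p − 1}`, a counterexample needs, inside a
single `q^k − 1`, Wieferich primes of total weighted mass `≥ εk log q − O(1)`; the two known base-2
Wieferich primes give `E_W(2,k) ∣ 1093 · 3511` for every `k` as far as anyone knows (searched to `2^{64}`). [folklore] -/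
theorem not_primePowerRadical_iff :
    ¬ PrimePowerRadical ↔ ∃ q : ℕ, q.Prime ∧ ∃ ε : ℝ, 0 < ε ∧ ∀ C : ℝ, 0 < C →
      ∃ k : ℕ, 1 ≤ k ∧ C * (q : ℝ) ^ (ε * k) ≤ (oddWieferichExcess q k : ℝ) := by
  rw [primePowerRadical_iff_wieferichSparse]
  simp only [not_forall, not_exists, not_and, not_lt, exists_prop]

/-- `1093` is a Wieferich prime to base `2` (Meissner 1913): `1093² ∣ 2^{1092} − 1`; in fact already
`1093² ∣ 2^{364} − 1` (`364 = ord_{1093} 2`), so `E_W(2, 364) ≥ 1093`. Kernel arithmetic. [folklore] -/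
theorem wieferich_1093 : 1093 ^ 2 ∣ 2 ^ 364 - 1 := by
  decide +kernel

/-- `3511` is a Wieferich prime to base `2` (Beeger 1922): `3511² ∣ 2^{1755} − 1` (`1755 = ord_{3511} 2`). [folklore] -/
theorem wieferich_3511 : 3511 ^ 2 ∣ 2 ^ 1755 - 1 := by
  decide +kernel

/-- `11` is a Wieferich prime to base `3`: `11² ∣ 3^5 − 1 = 242` — the abc triple `(1, 242, 243)` of
quality `1.3111`, inside the crux's family at `(q,k) = (3,5)`. [folklore] -/
theorem wieferich_11_base_3 : 11 ^ 2 ∣ 3 ^ 5 - 1 := by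
  decide

end Summit.ABC.ABC.Theorems.PrimePowerRadical.Negative

end
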